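import Summits.CriticalPhenomena.PercolationContinuityZ3.Theorems.PercNearOneGluingNoHeavyQuantGapSliceTwoBlob
import Summits.CriticalPhenomena.PercolationContinuityZ3.Theorems.PercNearOneGluingNoHeavyQuantGatedShiftDECHolds
import Summits.CriticalPhenomena.PercolationContinuityZ3.Theorems.PercNearOneGluingNoHeavyQuantGatedSliceWindow
import Summits.CriticalPhenomena.PercolationContinuityZ3.Theorems.PercNearOneGluingNoHeavyQuantDECAtTMixtures
import HarnessLib

/-!
# QUANT lane R8, T-DEC, leg (III), blob case: `GatedSliceMixLaw′` WITH `θ = 0` FOR EVERY HEAVY-TOPPED TWO-POINT LAW — the moved law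
# `P[μ₂] = z·δ₀ + (1−z)·slice {k₁,k₂;λ} a g` is the GATED SHIFT of a TWO-BLOB law, hence DEC at every layer whenever `(1−z)·λ ≥ y`;
# in particular CW holds for EVERY two-point law `ν` (`k₁ = 0`, all `k₂`)

builds on p205010 (kernel theorem, internal audit signed; external expert review pending)

Support file (`--supports stmt-CriticalPhenomena-4575`), QUANT lane seat prim-quant-arm-2 (gen 35), rung R8 of
`run/shared/lean/prim/quant/LADDER.md`.  Theorems only, standard axioms, no sorries, no definitions.  Uses this seat's
`…QuantGapSliceTwoBlob` (`sdecUpTo_twoBlob`, `sdecUpTo_blob`), typer g26's gated shift `gatedShift_sdecUpTo` (`…QuantGatedShiftDECHolds`),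
and the binder of typer g29's `LawDec.GatedSliceMixLaw'` (`…QuantGatedSliceMixLawPrime`; the law `weakMidLaw` of `…QuantGatedSliceWindow`).

THE OBSERVATION (arm-2 g35).  In `GatedSliceMixLaw'` the moved law of the two-point component `μ₂ = {k₁, k₂; λ}` (mean `S/(1−z)`) is
`P[μ₂] = z·δ₀ + (1−z)·slice μ₂ a g = gate_{1−z}((blob_{k₂−k₁, λ} ∗ blob_{a, g})(· − k₁))` (`movedPair_eq_gate_shift_twoBlob`): the gate by
`q = 1 − z` of the TWO-BLOB law `{0, k₂−k₁; λ} ∗ {0, a; g}` SHIFTED UP by `k₁` with the gate zero left at `0`.  The two-blob law is SDEC up to `q`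
at the base floor `x = y/q` as soon as both gates are heavy there, `λ, g ≥ y/(1−z)` (`sdecUpTo_twoBlob`: slice the larger blob by the smaller —
typer g27's move lemma needs no unshifted atom inside the smaller blob's range — and the slice theorem), and typer g26's GATED SHIFT THEOREM
(`gatedShift_sdecUpTo`, Conjecture R) says exactly that SDEC-up-to-`q` survives the shift of everything but the gate zero.  Hence:
* **`gatedSliceMixLaw_heavyTop`** — in the frame of `GatedSliceMixLaw'`, for EVERY `k₁ ≤ k₂ ≤ M` and `λ` with `(1−z)(k₁ + (k₂−k₁)λ) = S` and a
  HEAVY TOP `y ≤ (1−z)·λ`, the conclusion holds with `θ = 0` (the weak mid `h`, `W_h` and its non-DEC hypothesis are not used; the layer `j` is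
  arbitrary).
* **`gatedSliceMixLaw_zero`** — `k₁ = 0`, EVERY `k₂` (typer g29's `gatedSliceMixLaw_zero_ge` had `a ≤ k₂`): the top is automatically heavy
  (`y·k₂ ≤ y·M ≤ S = (1−z)λ·k₂`).  With the kernel reductions `gatedSliceWindowDEC_of_mixLaw'` / `windowMixDEC_of_mixLaw'` in mind: the blob step
  CW holds for every two-point law `ν` — as a law statement this is `sdecUpTo_twoBlob`.
* `decAtT_gate_of_sdecUpTo` — bookkeeping: `SDECUpTo x q N Λ` ⟹ `gate_q Λ` is DEC at EVERY layer at `(q·x, q·mean Λ)` on any declared top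
  `≥ N` (Theorem A above the top); `blob_laws`, `twoBlob_laws`.
READING FOR THE PROVER OF `GatedSliceMixLaw'` (typer line; arm-3 g63's anatomy): the genuinely mixed cells (`θ > 0`, regimes A/B) all have a
LIGHT top `(1−z)·λ < y`; this file settles the complementary heavy-top half at `θ = 0`, uniformly in `k₁` (no `hsupp`, no case `k₁ < a`).
HONEST STATUS: `GatedSliceMixLaw'`, `WindowMixDEC`/`GatedSliceWindowDEC`, `SingleGateConvClosed`, `TreeDEC`, `FarTreeRow` remain OPEN; the RATE
class log\* and the honest sentence of `run/shared/lean/prim/quant/README.md` are unchanged.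

[this work]; gated shift: prim-quant-stmt g26; move lemma: prim-quant-stmt g27; `GatedSliceMixLaw'`: prim-quant-stmt g29; anatomy: prim-quant-arm-3
g63 (this lane).  Nothing here is cited as a published result.  The gluing rows served [cite: KozmaNitzan2024, Conjecture 3 (p. 15)]; product
measure [cite: Grimmett1999, §1.3 p. 10].
-/

noncomputable section

namespace Summit.CriticalPhenomena.PercolationContinuityZ3.Theorems

namespace Quant

open Finset

/-- the two-point law `{lo, hi; g}` (as in `…QuantLawDEC`) -/
local notation3 "TP[" lo ", " hi ", " g ", " h "]" =>
  (g : ℝ) * (if (h : ℕ) = (hi : ℕ) then (1 : ℝ) else 0) + (1 - (g : ℝ)) * (if (h : ℕ) = (lo : ℕ) then (1 : ℝ) else 0)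

namespace LawDec

/-! ### From `SDECUpTo` of a law to `DECAtT` of its gate at the gated mean, on a larger declared top -/

/-- bookkeeping: if `Λ` (a top-affordable probability law on `{0..N}`) is SDEC up to `q` at floor `x`, then `gate Λ q` is DEC at EVERY layer `j`
at floor `q·x`, target `q·mean Λ`, on any declared top `M′ ≥ N` (layers `j ≥ N` by Theorem A `decAt_of_top_le`). [this work] -/
theorem decAtT_gate_of_sdecUpTo (x q : ℝ) (N M' j : ℕ) (Λ : ℕ → ℝ) (hx0 : 0 < x) (hq0 : 0 < q) (hq1 : q ≤ 1) (hqx : q * x < 1)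
    (hΛ0 : ∀ h, 0 ≤ Λ h) (hΛN : ∀ h, N < h → Λ h = 0) (hΛ1 : ∑ h ∈ Finset.range (N + 1), Λ h = 1)
    (hta : x * (N : ℝ) ≤ ∑ h ∈ Finset.range (N + 1), (h : ℝ) * Λ h) (hS : SDECUpTo x q N Λ) (hNM : N ≤ M') :
    DECAtT (q * x) (q * ∑ h ∈ Finset.range (N + 1), (h : ℝ) * Λ h) j M' (gate Λ q) := by
  obtain ⟨n0, nN, n1⟩ := gate_laws N Λ q hq0.le hq1 hΛ0 hΛN hΛ1
  have nmean : ∑ h ∈ Finset.range (N + 1), (h : ℝ) * gate Λ q h = q * ∑ h ∈ Finset.range (N + 1), (h : ℝ) * Λ h :=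
    sum_mul_gate Λ q N
  refine decAtT_mono_top ?_ hNM
  by_cases hjN : j < N
  · have h := hS q hq0 le_rfl j hjN
    rwa [decAt_iff_decAtT, nmean] at h
  · have htop : ∀ h, 0 < gate Λ q h → q * x * (h : ℝ) ≤ ∑ k ∈ Finset.range (N + 1), (k : ℝ) * gate Λ q k := by
      intro h hh
      have hhN : h ≤ N := by
        by_contra hc
        exact (ne_of_gt hh) (nN h (not_le.1 hc))
      rw [nmean]
      have h1 : q * x * (h : ℝ) ≤ q * x * N :=
        mul_le_mul_of_nonneg_left (by exact_mod_cast hhN) (mul_pos hq0 hx0).le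
      have h2 : q * (x * (N : ℝ)) ≤ q * ∑ k ∈ Finset.range (N + 1), (k : ℝ) * Λ k := mul_le_mul_of_nonneg_left hta hq0.le
      linarith
    have h := decAt_of_top_le N (gate Λ q) n0 nN n1 (q * x) hqx htop j (not_lt.1 hjN)
    rwa [decAt_iff_decAtT, nmean] at h

/-! ### Law facts of the two-blob law -/

/-- law facts of the heavy blob `TP[0, b, γ]` on `{0..b}`: nonnegative, zero above `b`, mass `1`, mean `b·γ`. [this work] -/
theorem blob_laws (b : ℕ) (γ : ℝ) (hγ0 : 0 ≤ γ) (hγ1 : γ ≤ 1) :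
    (∀ h, 0 ≤ TP[0, b, γ, h]) ∧ (∀ h, b < h → TP[0, b, γ, h] = 0) ∧ (∑ h ∈ Finset.range (b + 1), TP[0, b, γ, h] = 1) ∧
      (∑ h ∈ Finset.range (b + 1), (h : ℝ) * TP[0, b, γ, h] = (b : ℝ) * γ) := by
  refine ⟨fun h => ?_, fun h hh => ?_, ?_, ?_⟩
  · have : (0 : ℝ) ≤ 1 - γ := by linarith
    positivity
  · rw [if_neg (by omega), if_neg (by omega)]; ring
  · rw [Finset.sum_add_distrib, ← Finset.mul_sum, ← Finset.mul_sum, Finset.sum_ite_eq', Finset.sum_ite_eq',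
      if_pos (Finset.mem_range.2 (Nat.lt_succ_self b)), if_pos (Finset.mem_range.2 (Nat.succ_pos b))]
    ring
  · have e : ∀ h : ℕ, (h : ℝ) * TP[0, b, γ, h]
        = γ * (if h = b then (h : ℝ) else 0) + (1 - γ) * (if h = 0 then (h : ℝ) else 0) := fun h => by
      split_ifs <;> ring
    simp_rw [e]
    rw [Finset.sum_add_distrib, ← Finset.mul_sum, ← Finset.mul_sum, Finset.sum_ite_eq', Finset.sum_ite_eq',
      if_pos (Finset.mem_range.2 (Nat.lt_succ_self b)), if_pos (Finset.mem_range.2 (Nat.succ_pos b))]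
    push_cast; ring

/-- law facts of the two-blob law `slice TP[0, b, γ] a g` on `{0..b+a}`: nonnegative, zero above `b + a`, mass `1`, mean `b·γ + a·g`. [this work] -/
theorem twoBlob_laws (a b : ℕ) (γ g : ℝ) (hγ0 : 0 ≤ γ) (hγ1 : γ ≤ 1) (hg0 : 0 ≤ g) (hg1 : g ≤ 1) :
    (∀ h, 0 ≤ slice (fun t => TP[0, b, γ, t]) a g h) ∧ (∀ h, b + a < h → slice (fun t => TP[0, b, γ, t]) a g h = 0) ∧
      (∑ h ∈ Finset.range (b + a + 1), slice (fun t => TP[0, b, γ, t]) a g h = 1) ∧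
      (∑ h ∈ Finset.range (b + a + 1), (h : ℝ) * slice (fun t => TP[0, b, γ, t]) a g h = (b : ℝ) * γ + (a : ℝ) * g) := by
  obtain ⟨b0, bM, b1, bmean⟩ := blob_laws b γ hγ0 hγ1
  exact ⟨slice_nonneg _ a g hg0 hg1 b0, slice_eq_zero _ a g b bM, sum_slice _ a g b bM b1,
    by rw [sum_mul_slice _ a g b bM b1, bmean]⟩

/-- **the moved two-point law of `GatedSliceMixLaw` is a gated, shifted two-blob law**: for `k₂ = k₁ + b`,
`z·δ₀ + (1−z)·slice TP[k₁, k₂, λ] a g = gate_{1−z} (shift_{k₁} (slice TP[0, b, λ] a g))`. [this work] -/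
theorem movedPair_eq_gate_shift_twoBlob (z lam g : ℝ) (k₁ b a : ℕ) :
    (fun p => z * (if p = 0 then (1 : ℝ) else 0) + (1 - z) * slice (fun q => TP[k₁, k₁ + b, lam, q]) a g p)
      = gate (fun t => if k₁ ≤ t then slice (fun q => TP[0, b, lam, q]) a g (t - k₁) else 0) (1 - z) := by
  funext p
  simp only [gate, slice_TP]
  by_cases hkp : k₁ ≤ p
  · rw [if_pos hkp]
    have e1 : (p - k₁ = b) ↔ (p = k₁ + b) := by omega
    have e2 : (p - k₁ = 0) ↔ (p = k₁) := by omega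
    have e3 : (p - k₁ = b + a) ↔ (p = k₁ + b + a) := by omega
    have e4 : (p - k₁ = 0 + a) ↔ (p = k₁ + a) := by omega
    simp only [e1, e2, e3, e4]
    by_cases hp0 : p = 0
    · simp only [if_pos hp0]; ring
    · simp only [if_neg hp0]; ring
  · have h1 : p ≠ k₁ + b := by omega
    have h2 : p ≠ k₁ := by omega
    have h3 : p ≠ k₁ + a := by omega
    have h4 : p ≠ k₁ + b + a := by omega
    simp only [if_neg hkp, if_neg h1, if_neg h2, if_neg h3, if_neg h4]
    by_cases hp0 : p = 0
    · simp only [if_pos hp0]; ring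
    · simp only [if_neg hp0]; ring

/-! ### The heavy-top cells of `GatedSliceMixLaw′` (`θ = 0`) -/

/-- **`GatedSliceMixLaw′` WITH `θ = 0` FOR EVERY HEAVY-TOPPED TWO-POINT LAW.**  In the frame of `LawDec.GatedSliceMixLaw'` (`0 < y < 1`,
`0 ≤ z < 1`, `g ≤ 1`, `y ≤ (1−z)·g`, `1 ≤ a`, `j < M + a`, `0 < S`, `y·M ≤ S`), for every two-point law `μ₂ = {k₁, k₂; λ}` on `{0..M}` of mean
`S/(1−z)` whose TOP IS HEAVY at the gated floor — `y ≤ (1−z)·λ` — the moved law `P[μ₂] = z·δ₀ + (1−z)·slice μ₂ a g` is ITSELF DEC at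
`(y, S + a g (1−z), j)` (so `θ = 0` works; the weak mid `h` and `W_h` are not used).  Proof: `P[μ₂]` is the gate by `q = 1−z` of the two-blob law
`{0, k₂−k₁; λ} ∗ {0, a; g}` shifted up by `k₁` (`movedPair_eq_gate_shift_twoBlob`); the two-blob law is SDEC up to `q` at floor `y/q`
(`sdecUpTo_twoBlob`, both gates `≥ y/q`), typer g26's gated shift `gatedShift_sdecUpTo` carries this through the shift, and the target is the
gated mean.  (`k₁ = k₂`: the law is a gated shifted blob.)  The genuinely mixed cells of `GatedSliceMixLaw'` (`θ > 0`) are thus confined to LIGHT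
tops `(1−z)·λ < y`. [this work] -/
theorem gatedSliceMixLaw_heavyTop (y z g S lam : ℝ) (a j M h k₁ k₂ : ℕ)
    (hy0 : 0 < y) (hy1 : y < 1) (hz0 : 0 ≤ z) (hz1 : z < 1) (hg1 : g ≤ 1) (hyg : y ≤ (1 - z) * g) (ha : 1 ≤ a)
    (hS0 : 0 < S) (hk : k₁ ≤ k₂) (hk₂M : k₂ ≤ M) (hlam0 : 0 ≤ lam) (hlam1 : lam ≤ 1)
    (hmean : (1 - z) * ((k₁ : ℝ) + ((k₂ : ℝ) - k₁) * lam) = S)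
    (hheavy : y ≤ (1 - z) * lam) :
    ∃ θ : ℝ, 0 ≤ θ ∧ θ < 1 ∧
      DECAtT y (S + (a : ℝ) * g * (1 - z)) j (M + a)
        (fun p => θ * weakMidLaw S g h a p
          + (1 - θ) * (z * (if p = 0 then (1 : ℝ) else 0) + (1 - z) * slice (fun q => TP[k₁, k₂, lam, q]) a g p)) := by
  refine ⟨0, le_rfl, zero_lt_one, ?_⟩
  have e0 : (fun p => (0 : ℝ) * weakMidLaw S g h a p
      + (1 - 0) * (z * (if p = 0 then (1 : ℝ) else 0) + (1 - z) * slice (fun q => TP[k₁, k₂, lam, q]) a g p))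
      = fun p => z * (if p = 0 then (1 : ℝ) else 0) + (1 - z) * slice (fun q => TP[k₁, k₂, lam, q]) a g p := by
    funext p; ring
  rw [e0]
  -- the gate `q = 1 - z` and the base floor `x = y / q`
  set q : ℝ := 1 - z with hq
  have hq0 : 0 < q := by rw [hq]; linarith
  have hq1 : q ≤ 1 := by rw [hq]; linarith
  set x : ℝ := y / q with hx
  have hx0 : 0 < x := div_pos hy0 hq0
  have hqx : q * x = y := by rw [hx]; field_simp
  have hqx1 : q * x < 1 := by rw [hqx]; exact hy1
  have hxg : x ≤ g := by rw [hx, div_le_iff₀ hq0]; linarith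
  have hxlam : x ≤ lam := by rw [hx, div_le_iff₀ hq0]; linarith
  have hg0 : 0 ≤ g := hx0.le.trans hxg
  obtain ⟨b, rfl⟩ : ∃ b, k₂ = k₁ + b := ⟨k₂ - k₁, by omega⟩
  -- the two-blob law and its shift
  set L : ℕ → ℝ := slice (fun t => TP[0, b, lam, t]) a g with hL
  obtain ⟨L0, LM, L1, Lmean⟩ := twoBlob_laws a b lam g hlam0 hlam1 hg0 hg1
  have Lta : x * ((b + a : ℕ) : ℝ) ≤ ∑ t ∈ Finset.range (b + a + 1), (t : ℝ) * L t := by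
    rw [hL, Lmean]; push_cast
    nlinarith [mul_le_mul_of_nonneg_left hxlam (Nat.cast_nonneg b), mul_le_mul_of_nonneg_left hxg (Nat.cast_nonneg a)]
  set Lk : ℕ → ℝ := fun t => if k₁ ≤ t then L (t - k₁) else 0 with hLk
  obtain ⟨Lk0, LkM, Lk1, Lkmean⟩ := shift_laws k₁ (b + a) L L0 LM L1
  have hLkS : SDECUpTo x q (k₁ + (b + a)) Lk := by
    rcases Nat.eq_zero_or_pos k₁ with hk0 | hkpos
    · -- no shift
      have e : Lk = L := by
        funext t; rw [hLk]; simp only [hk0, zero_le, if_true, Nat.sub_zero]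
      rw [e, hk0, Nat.zero_add]
      rcases Nat.eq_zero_or_pos b with hb0 | hbpos
      · -- `k₁ = k₂ = 0`: then `S = 0`, excluded
        exfalso
        have : S = 0 := by rw [← hmean]; simp [hk0, hb0]
        linarith
      · exact sdecUpTo_twoBlob x q lam g b a hx0 hq1 hqx1 hxlam hlam1 hxg hg1 hbpos ha
    · have hLS : SDECUpTo x q (b + a) L := by
        rcases Nat.eq_zero_or_pos b with hb0 | hbpos
        · -- `k₁ = k₂ ≥ 1`: `L` is the blob law `TP[0, a, g]` (the pair `TP[0,0,λ]` is `δ₀`)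
          have e : L = fun t => TP[0, a, g, t] := by
            rw [hL, hb0]
            have e1 : (fun t : ℕ => TP[0, 0, lam, t]) = fun t => if t = 0 then (1 : ℝ) else 0 := by
              funext t; split_ifs <;> ring
            rw [e1, slice_delta_zero a g ha]
          rw [e, hb0, Nat.zero_add]
          exact sdecUpTo_blob x q g a hx0 hq1 hqx1 hxg hg1 ha
        · exact sdecUpTo_twoBlob x q lam g b a hx0 hq1 hqx1 hxlam hlam1 hxg hg1 hbpos ha
      exact gatedShift_sdecUpTo x q k₁ (b + a) L hx0 (hxg.trans hg1) hq1 hqx1 hkpos L0 LM L1 Lta hLS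
  have Lkta : x * ((k₁ + (b + a) : ℕ) : ℝ) ≤ ∑ t ∈ Finset.range (k₁ + (b + a) + 1), (t : ℝ) * Lk t := by
    rw [Lkmean]
    have hx1 : x ≤ 1 := hxg.trans hg1
    have : x * (k₁ : ℝ) ≤ k₁ := by nlinarith [(Nat.cast_nonneg k₁ : (0 : ℝ) ≤ k₁)]
    push_cast at Lta ⊢
    nlinarith
  have hdec := decAtT_gate_of_sdecUpTo x q (k₁ + (b + a)) (M + a) j Lk hx0 hq0 hq1 hqx1 Lk0 LkM Lk1 Lkta hLkS (by omega)
  rw [hqx, Lkmean, hL, Lmean] at hdec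
  have et : q * ((b : ℝ) * lam + (a : ℝ) * g + (k₁ : ℝ)) = S + (a : ℝ) * g * (1 - z) := by
    rw [← hmean, hq]; push_cast; ring
  rw [et] at hdec
  have elaw := movedPair_eq_gate_shift_twoBlob z lam g k₁ b a
  rw [show (1 : ℝ) - z = q from rfl] at elaw
  rw [elaw]
  exact hdec

/-- **`GatedSliceMixLaw′` WITH `θ = 0` FOR EVERY ZERO-BASED TWO-POINT LAW `{0, k₂; λ}`** — ALL `k₂` (typer g29's `gatedSliceMixLaw_zero_ge`
needed `a ≤ k₂`): the top is automatically heavy (`y·k₂ ≤ y·M ≤ S = (1−z)·λ·k₂`).  With the reduction `gatedSliceWindowDEC_of_mixLaw'` this is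
CW for every two-point law `ν`. [this work] -/
theorem gatedSliceMixLaw_zero (y z g S lam : ℝ) (a j M h k₂ : ℕ)
    (hy0 : 0 < y) (hy1 : y < 1) (hz0 : 0 ≤ z) (hz1 : z < 1) (hg1 : g ≤ 1) (hyg : y ≤ (1 - z) * g) (ha : 1 ≤ a)
    (hS0 : 0 < S) (hta : y * (M : ℝ) ≤ S)
    (hk₂M : k₂ ≤ M) (hlam0 : 0 ≤ lam) (hlam1 : lam ≤ 1) (hmean : (1 - z) * (((0 : ℕ) : ℝ) + ((k₂ : ℝ) - (0 : ℕ)) * lam) = S) :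
    ∃ θ : ℝ, 0 ≤ θ ∧ θ < 1 ∧
      DECAtT y (S + (a : ℝ) * g * (1 - z)) j (M + a)
        (fun p => θ * weakMidLaw S g h a p
          + (1 - θ) * (z * (if p = 0 then (1 : ℝ) else 0) + (1 - z) * slice (fun q => TP[0, k₂, lam, q]) a g p)) := by
  have hmean' : (1 - z) * lam * (k₂ : ℝ) = S := by
    rw [← hmean]; simp only [Nat.cast_zero, zero_add, sub_zero]; ring
  have hk0 : (0 : ℝ) < k₂ := by
    rcases (Nat.cast_nonneg k₂ : (0 : ℝ) ≤ k₂).eq_or_lt with h0 | h0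
    · exfalso; rw [← h0, mul_zero] at hmean'; linarith
    · exact h0
  have hheavy : y ≤ (1 - z) * lam := by
    have h1 : y * (k₂ : ℝ) ≤ S := (mul_le_mul_of_nonneg_left (by exact_mod_cast hk₂M) hy0.le).trans hta
    rw [← hmean'] at h1
    exact le_of_mul_le_mul_right h1 hk0
  exact gatedSliceMixLaw_heavyTop y z g S lam a j M h 0 k₂ hy0 hy1 hz0 hz1 hg1 hyg ha hS0 (Nat.zero_le _) hk₂M hlam0 hlam1
    hmean hheavy

end LawDec

end Quant

end Summit.CriticalPhenomena.PercolationContinuityZ3.Theorems
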